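import Mathlib

/-!
# Stub `stub_hypDensityInvariant` — line `Sketch`, crux `VoronoiHubFromSmirnov`

Crux item: stmt-CriticalPhenomena-6433.

Card "hyperbolic-intensity-exact-ci", first lemma: the hyperbolic area density `(1 - ‖z‖²)⁻²` on
the unit disc is *exactly* invariant under every disc automorphism
`ψ w = e^{iθ} (w - a) / (1 - ā w)` (`‖a‖ < 1`), i.e. the Schwarz–Pick equality
`‖ψ' z‖² / (1 - ‖ψ z‖²)² = 1 / (1 - ‖z‖²)²` for `‖z‖ < 1`.
Proof: `ψ' z = e^{iθ} (1 - a ā) / (1 - ā z)²` by the quotient rule,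
`‖ψ z‖² = ‖z - a‖² / ‖1 - ā z‖²`, and the classical identity
`‖1 - ā z‖² - ‖z - a‖² = (1 - ‖a‖²) (1 - ‖z‖²)`; the rest is a real field identity.  Mathlib only.
-/

open Complex

namespace Summit.CriticalPhenomena.CardyFormulaZ2.Cruxes.VoronoiHubFromSmirnov.SketchLine

/-- The classical unit-disc identity `‖1 - ā z‖² - ‖z - a‖² = (1 - ‖a‖²) (1 - ‖z‖²)`,
valid for all `a z : ℂ`. [folklore] -/
theorem hypDensity_norm_identity (a z : ℂ) :
    ‖1 - starRingEnd ℂ a * z‖ ^ 2 - ‖z - a‖ ^ 2 = (1 - ‖a‖ ^ 2) * (1 - ‖z‖ ^ 2) := by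
  simp only [Complex.sq_norm, Complex.normSq_apply, Complex.sub_re, Complex.sub_im, Complex.mul_re,
    Complex.mul_im, Complex.one_re, Complex.one_im, Complex.conj_re, Complex.conj_im]
  ring

/-- For `‖a‖ < 1` and `‖z‖ < 1` the denominator `1 - ā z` of a disc automorphism does not
vanish (indeed `‖ā z‖ < 1`). [folklore] -/
theorem hypDensity_denom_ne_zero (a : ℂ) (ha : ‖a‖ < 1) (z : ℂ) (hz : ‖z‖ < 1) :
    1 - starRingEnd ℂ a * z ≠ 0 := by
  intro h
  have h1 : starRingEnd ℂ a * z = 1 := by linear_combination -h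
  have h2 : ‖starRingEnd ℂ a * z‖ < 1 := by
    rw [norm_mul, Complex.norm_conj]
    nlinarith [norm_nonneg a, norm_nonneg z]
  rw [h1, norm_one] at h2
  exact lt_irrefl _ h2

/-- Quotient rule for the disc automorphism `w ↦ e^{iθ} (w - a) / (1 - ā w)`: at any point `z`
with `1 - ā z ≠ 0` its derivative is `e^{iθ} (1 - a ā) / (1 - ā z)²`. [folklore] -/
theorem hypDensity_hasDerivAt (a : ℂ) (θ : ℝ) (z : ℂ) (hd : 1 - starRingEnd ℂ a * z ≠ 0) :
    HasDerivAt (fun w => exp ((θ : ℂ) * I) * (w - a) / (1 - (starRingEnd ℂ a) * w))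
      (exp ((θ : ℂ) * I) * (1 - a * starRingEnd ℂ a) / (1 - starRingEnd ℂ a * z) ^ 2) z := by
  have hnum : HasDerivAt (fun w => exp ((θ : ℂ) * I) * (w - a)) (exp ((θ : ℂ) * I) * 1) z :=
    ((hasDerivAt_id' z).sub_const a).const_mul _
  have hden : HasDerivAt (fun w => 1 - starRingEnd ℂ a * w) (-(starRingEnd ℂ a * 1)) z :=
    ((hasDerivAt_id' z).const_mul _).const_sub 1
  refine (hnum.fun_div hden hd).congr_deriv ?_
  ring

/-- **Schwarz–Pick equality for disc automorphisms** (card hyperbolic-intensity-exact-ci of crux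
`VoronoiHubFromSmirnov`, first lemma): for `‖a‖ < 1`, `θ : ℝ` and the disc automorphism
`ψ w = e^{iθ} (w - a) / (1 - ā w)`, the hyperbolic area density is exactly invariant:
`‖ψ' z‖² / (1 - ‖ψ z‖²)² = 1 / (1 - ‖z‖²)²` for every `‖z‖ < 1`. [folklore] -/
theorem stub_hypDensityInvariant (a : ℂ) (ha : ‖a‖ < 1) (θ : ℝ) (z : ℂ) (hz : ‖z‖ < 1) :
    let ψ : ℂ → ℂ := fun w => exp ((θ : ℂ) * I) * (w - a) / (1 - (starRingEnd ℂ a) * w)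
    ‖deriv ψ z‖ ^ 2 / (1 - ‖ψ z‖ ^ 2) ^ 2 = 1 / (1 - ‖z‖ ^ 2) ^ 2 := by
  intro ψ
  have hd : 1 - starRingEnd ℂ a * z ≠ 0 := hypDensity_denom_ne_zero a ha z hz
  have hderiv : deriv ψ z
      = exp ((θ : ℂ) * I) * (1 - a * starRingEnd ℂ a) / (1 - starRingEnd ℂ a * z) ^ 2 :=
    (hypDensity_hasDerivAt a θ z hd).deriv
  have hψz : ψ z = exp ((θ : ℂ) * I) * (z - a) / (1 - starRingEnd ℂ a * z) := rfl
  -- the real quantities entering the computation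
  have hD : 0 < ‖1 - starRingEnd ℂ a * z‖ := norm_pos_iff.mpr hd
  have hA : ‖a‖ ^ 2 < 1 := by nlinarith [norm_nonneg a]
  have hZ : ‖z‖ ^ 2 < 1 := by nlinarith [norm_nonneg z]
  have hexp : ‖exp ((θ : ℂ) * I)‖ = 1 := Complex.norm_exp_ofReal_mul_I θ
  have haa : ‖1 - a * starRingEnd ℂ a‖ = 1 - ‖a‖ ^ 2 := by
    rw [Complex.mul_conj, Complex.normSq_eq_norm_sq]
    have : (1 : ℂ) - ((‖a‖ ^ 2 : ℝ) : ℂ) = ((1 - ‖a‖ ^ 2 : ℝ) : ℂ) := by push_cast; ring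
    rw [this, Complex.norm_of_nonneg (by linarith)]
  have key := hypDensity_norm_identity a z
  have h1 : ‖deriv ψ z‖ ^ 2 = (1 - ‖a‖ ^ 2) ^ 2 / (‖1 - starRingEnd ℂ a * z‖ ^ 2) ^ 2 := by
    rw [hderiv, norm_div, norm_mul, norm_pow, hexp, haa, one_mul]
    ring
  have h2 : 1 - ‖ψ z‖ ^ 2
      = (1 - ‖a‖ ^ 2) * (1 - ‖z‖ ^ 2) / ‖1 - starRingEnd ℂ a * z‖ ^ 2 := by
    rw [hψz, norm_div, norm_mul, hexp, one_mul, ← key, div_pow, sub_div,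
      div_self (pow_ne_zero 2 hD.ne')]
  -- freeze the real atoms and finish with a field identity
  set D : ℝ := ‖1 - starRingEnd ℂ a * z‖
  have hD' : D ≠ 0 := hD.ne'
  have hA' : 1 - ‖a‖ ^ 2 ≠ 0 := by linarith
  have hZ' : 1 - ‖z‖ ^ 2 ≠ 0 := by linarith
  rw [h1, h2]
  field_simp

end Summit.CriticalPhenomena.CardyFormulaZ2.Cruxes.VoronoiHubFromSmirnov.SketchLine
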